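import Mathlib.Analysis.Calculus.Deriv.Star
import Literature.NumberTheory.LFunctions.RayClassLSeriesNonvanishing
import HarnessLib

/-!
# `L(1 + it, χ) ≠ 0` for every non-principal ray class character `χ mod 𝔪` (the whole line `Re s = 1`)

Topic `Literature/NumberTheory/LFunctions`; namespace `Literature.NumberTheory.LFunctions`. Pure-proof
file (theorems only; no definition, no named fact), sequel of `RayClassLSeriesNonvanishing.lean`
(`rayClassLSeries_entire_apply_one_ne_zero`: the point `s = 1`).

**Theorem (Hecke 1917; Landau 1918; Iwasawa, *Hecke's `L`-functions* (Princeton lectures 1964),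
Ch. 4 §4.2, Prop. 4.4: "For any real `y`, `L(1 + iy; χ) ≠ 0`").**  For a number field `K`, a
nonzero ideal `𝔪`, a NON-PRINCIPAL ray class character `χ mod 𝔪` and an entire continuation `g` of
`L(χ, s) = rayClassLSeries 𝔪 ψ s` from `Re s > 1`: `g(s₀) ≠ 0` for every `s₀` with `Re s₀ = 1`
(`rayClassLSeries_entire_apply_ne_zero_of_re_eq_one`).  This is the input "by nonvanishing results
for Hecke `L`-functions" of Heilbronn's "Artin `L`-functions formed with non-principal characters are
regular and non-zero for `σ ≥ 1`" (Cassels–Fröhlich Ch. VIII §3) and of Booker 2003, p. 1091.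

Proof: Landau's method exactly as at `s = 1` (`rayClassLSeries_continuation_apply_one_ne_zero`), run
with the TWISTED coefficients `c_v = χ'(v) N(v)^{-it}`, `t = Im s₀` (still `|c_v| ≤ 1`): the Euler
products `∏_v (1 - c_v N(v)^{-s})⁻¹ = L(χ, s + it)` and `∏_v (1 - c̄_v N(v)^{-s})⁻¹ = L(χ̄, s - it)`
(`hasProd_rayClassLSeries_rayClassPrimeValue` at `s ± it`) are continued by `s ↦ g(s + it)` and
`s ↦ ḡ(s - it)`, `ḡ` Hecke's entire continuation of `L(χ̄, ·)` (`exists_differentiable_eq_rayClassLSeries`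
for the conjugate character, `IsRayClassCharacter.conj`); if `g(1 + it) = 0` then also
`ḡ(1 - it) = conj g(1 + it) = 0` — because `ḡ(s) = conj g(conj s)` identically
(`rayClassLSeries_conj`: `L(χ̄, s) = conj L(χ, s̄)` termwise on `Re s > 1`, and the identity theorem
for the entire functions `ḡ`, `conj ∘ g ∘ conj`) — and Landau's lemma
`GaloisRepresentations.false_of_landauSeries` (`exp F = ζ_K² · g(· + it) · ḡ(· - it)`,
`cexp_genDirichlet_landau_eq`) gives the contradiction.  (Iwasawa's printed proof is the `3, 4, 1`
inequality, Lemma 4.3; the idelic version by twisting with `‖·‖^{it}` is the tree's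
`HeckeCharacter.continuation_apply_ne_zero_of_re_eq_one`.)

## References

* K. Iwasawa, *Hecke's `L`-functions* (Princeton lectures 1964), SpringerBriefs 2019, Ch. 4 §4.2
  Prop. 4.4 (PDF p. 72 of the held copy). [Iwasawa2019]
* E. Landau, *Über Ideale und Primideale in Idealklassen*, Math. Z. 2 (1918), 52–154, §§13–16.
* J. Neukirch, *Algebraic Number Theory* (1999), Ch. VII (8.1), (8.5)–(8.6). [NeukirchANT1999]
* H. Heilbronn, in Cassels–Fröhlich, *Algebraic Number Theory* (1967), Ch. VIII §3. [HeilbronnZetaL1967]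

## Mathlib / tree search

Tree: `rayClassLSeries_continuation_apply_one_ne_zero`, `rayClassLSeries_conj_ofReal`,
`IsRayClassCharacter.conj`, `hasProd_rayClassLSeries_rayClassPrimeValue`, `hasSum_rayClassLSeries`,
`exists_differentiable_eq_rayClassLSeries`, `GaloisRepresentations.false_of_landauSeries`,
`cexp_genDirichlet_landau_eq`.  `lean search 'rayClassLSeries.*re_eq_one|apply_ne_zero_of_re_eq_one'`:
only the idelic `HeckeCharacter.continuation_apply_ne_zero_of_re_eq_one`.  Mathlib:
`differentiableAt_conj_conj_iff`, `Complex.conj_cpow`, `Complex.conj_tsum`,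
`AnalyticOnNhd.eqOn_of_preconnected_of_eventuallyEq`.
-/

noncomputable section

open Complex Filter Topology Set IsDedekindDomain NumberField
open scoped ComplexConjugate

namespace Literature.NumberTheory.LFunctions

variable {K : Type*} [Field K] [NumberField K]

/-! ### `L(χ̄, s) = conj L(χ, s̄)` -/

/-- `conj (N^{w}) = N^{conj w}` for a natural number `N`. [folklore] -/
theorem conj_natCast_cpow (N : ℕ) (w : ℂ) : conj ((N : ℂ) ^ w) = (N : ℂ) ^ conj w := by
  rw [cpow_conj _ _ (by rw [natCast_arg]; exact Real.pi_pos.ne), conj_natCast]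

/-- **`L(χ̄, s) = conj L(χ, s̄)` for `Re s > 1`** (conjugate the absolutely convergent series (8.1)
termwise; the tree's `rayClassLSeries_conj_ofReal` is the case of real `s`).
[cite: NeukirchANT1999, Ch. VII §8 (8.1) Proposition] -/
theorem rayClassLSeries_conj {𝔪 : Ideal (𝓞 K)} (h𝔪 : 𝔪 ≠ ⊥) {ψ : HeightOneSpectrum (𝓞 K) → ℂ}
    (hψ : ∀ v : HeightOneSpectrum (𝓞 K), ¬ 𝔪 ≤ v.asIdeal → ‖ψ v‖ ≤ 1) {s : ℂ} (hs : 1 < s.re) :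
    rayClassLSeries 𝔪 (fun v => conj (ψ v)) s = conj (rayClassLSeries 𝔪 ψ (conj s)) := by
  have hs' : 1 < (conj s).re := by rwa [conj_re]
  have hψ' : ∀ v : HeightOneSpectrum (𝓞 K), ¬ 𝔪 ≤ v.asIdeal → ‖conj (ψ v)‖ ≤ 1 := fun v hv => by
    rw [Complex.norm_conj]; exact hψ v hv
  have h1 := hasSum_rayClassLSeries h𝔪 hψ hs'
  have h2 := hasSum_rayClassLSeries h𝔪 hψ' hs
  have h3 : HasSum (fun I : Ideal (𝓞 K) =>
      conj (rayClassCoeff 𝔪 ψ I * ((Ideal.absNorm I : ℕ) : ℂ) ^ (-conj s)))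
      (conj (rayClassLSeries 𝔪 ψ (conj s))) :=
    h1.map (starRingEnd ℂ : ℂ →+* ℂ).toAddMonoidHom Complex.continuous_conj
  refine h2.unique (h3.congr_fun fun I => ?_)
  simp only [map_mul, rayClassCoeff_conj, conj_natCast_cpow, map_neg, Complex.conj_conj]

/-- **Reflection principle for the continuations**: if `g` is an entire continuation of `L(χ, ·)`
and `ḡ` one of `L(χ̄, ·)` (from `Re s > 1`), then `ḡ(s) = conj g(conj s)` for all `s` (both sides
are entire and agree on `Re s > 1` by `rayClassLSeries_conj`; identity theorem). [folklore] -/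
theorem rayClassLSeries_continuation_conj_eq {𝔪 : Ideal (𝓞 K)} (h𝔪 : 𝔪 ≠ ⊥)
    {ψ : HeightOneSpectrum (𝓞 K) → ℂ}
    (hψ : ∀ v : HeightOneSpectrum (𝓞 K), ¬ 𝔪 ≤ v.asIdeal → ‖ψ v‖ ≤ 1)
    {g g' : ℂ → ℂ} (hg : Differentiable ℂ g)
    (hg_eq : ∀ s : ℂ, 1 < s.re → g s = rayClassLSeries 𝔪 ψ s) (hg' : Differentiable ℂ g')
    (hg'_eq : ∀ s : ℂ, 1 < s.re → g' s = rayClassLSeries 𝔪 (fun v => conj (ψ v)) s) (s : ℂ) :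
    g' s = conj (g (conj s)) := by
  have hcc : Differentiable ℂ (conj ∘ g ∘ conj) := fun z =>
    differentiableAt_conj_conj_iff.mpr (hg (conj z))
  have han : AnalyticOnNhd ℂ (fun z : ℂ => conj (g (conj z))) univ := fun z _ => hcc.analyticAt z
  have han' : AnalyticOnNhd ℂ g' univ := fun z _ => hg'.analyticAt z
  have hev : g' =ᶠ[𝓝 (2 : ℂ)] fun z : ℂ => conj (g (conj z)) := by
    have hopen : IsOpen {z : ℂ | 1 < z.re} := isOpen_lt continuous_const Complex.continuous_re
    filter_upwards [hopen.mem_nhds (by norm_num : (1 : ℝ) < (2 : ℂ).re)] with z hz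
    have hz' : 1 < (conj z).re := by rwa [conj_re]
    rw [hg'_eq z hz, hg_eq _ hz', rayClassLSeries_conj h𝔪 hψ hz]
  exact han'.eqOn_of_preconnected_of_eventuallyEq han isPreconnected_univ (mem_univ 2) hev
    (mem_univ s)

/-! ### `L(1 + it, χ) ≠ 0` -/

/-- `‖N^{-it}‖ = 1` for a natural number `N ≥ 1` and real `t`. [folklore] -/
theorem norm_natCast_cpow_neg_I_mul {N : ℕ} (hN : 0 < N) (t : ℝ) :
    ‖(N : ℂ) ^ (-(I * t))‖ = 1 := by
  rw [norm_natCast_cpow_of_pos hN]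
  simp

/-- **`L(1 + it, χ) ≠ 0` for a non-principal ray class character** (Hecke 1917, Landau 1918;
Iwasawa, *Hecke's `L`-functions*, Prop. 4.4: "For any real `y`, `L(1 + iy; χ) ≠ 0`"), entire form:
for `𝔪 ≠ 0`, a ray class character `χ mod 𝔪` with `ψ(𝔭) ≠ 1` for some `𝔭 ∤ 𝔪`, and an entire `g`
with `g = L(χ, ·)` on `Re s > 1`: `g(s₀) ≠ 0` whenever `Re s₀ = 1`.  Proof: Landau's lemma
(`GaloisRepresentations.false_of_landauSeries`) with the twisted coefficients
`c_v = χ'(v) N(v)^{-it}`, `t = Im s₀`, whose Euler products are `L(χ, s + it) = g(s + it)` and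
`L(χ̄, s - it) = ḡ(s - it)` (`hasProd_rayClassLSeries_rayClassPrimeValue`), `ḡ` Hecke's entire
continuation of `L(χ̄, ·)`; `ḡ(1 - it) = conj g(1 + it)` by `rayClassLSeries_continuation_conj_eq`.
[cite: Iwasawa2019, Ch. 4 §4.2 Prop. 4.4] [cite: NeukirchANT1999, Ch. VII §8 Thm. (8.5)] -/
theorem rayClassLSeries_entire_apply_ne_zero_of_re_eq_one {𝔪 : Ideal (𝓞 K)} (h𝔪 : 𝔪 ≠ ⊥)
    {ψ : HeightOneSpectrum (𝓞 K) → ℂ} (hψ : IsRayClassCharacter 𝔪 ψ)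
    (hnt : ∃ v : HeightOneSpectrum (𝓞 K), ¬ 𝔪 ≤ v.asIdeal ∧ ψ v ≠ 1)
    {g : ℂ → ℂ} (hg : Differentiable ℂ g) (hg_eq : ∀ s : ℂ, 1 < s.re → g s = rayClassLSeries 𝔪 ψ s)
    {s₀ : ℂ} (hs₀ : s₀.re = 1) : g s₀ ≠ 0 := by
  intro h0
  set t : ℝ := s₀.im with ht
  have hs₀' : s₀ = 1 + I * t := Complex.ext (by simp [hs₀]) (by simp [ht])
  have hψle : ∀ v : HeightOneSpectrum (𝓞 K), ¬ 𝔪 ≤ v.asIdeal → ‖ψ v‖ ≤ 1 :=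
    fun v hv => (hψ.norm_eq_one v hv).le
  -- the conjugate character and Hecke's entire continuation of its `L`-series
  set ψc : HeightOneSpectrum (𝓞 K) → ℂ := fun v => conj (ψ v) with hψc
  have hψc' : IsRayClassCharacter 𝔪 ψc := hψ.conj
  have hψcle : ∀ v : HeightOneSpectrum (𝓞 K), ¬ 𝔪 ≤ v.asIdeal → ‖ψc v‖ ≤ 1 := fun v hv => by
    rw [hψc, Complex.norm_conj]; exact hψle v hv
  have hntc : ∃ v : HeightOneSpectrum (𝓞 K), ¬ 𝔪 ≤ v.asIdeal ∧ ψc v ≠ 1 := by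
    obtain ⟨v, hv, hv1⟩ := hnt
    refine ⟨v, hv, fun h => hv1 ?_⟩
    have := congrArg conj h
    simpa [hψc] using this
  obtain ⟨g', hg'd, hg'eq⟩ := exists_differentiable_eq_rayClassLSeries h𝔪 hψc' hntc
  -- the translated continuations `G(s) = g(s + it)`, `G'(s) = ḡ(s - it)`
  set G : ℂ → ℂ := fun s => g (s + I * t) with hG
  set G' : ℂ → ℂ := fun s => g' (s - I * t) with hG'
  have hGd : Differentiable ℂ G := hg.comp (differentiable_id.add_const _)
  have hG'd : Differentiable ℂ G' := hg'd.comp (differentiable_id.sub_const _)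
  have hG1 : G 1 = 0 := by
    simp only [hG]
    rwa [← hs₀']
  have hG'1 : G' 1 = 0 := by
    simp only [hG']
    rw [rayClassLSeries_continuation_conj_eq h𝔪 hψle hg hg_eq hg'd hg'eq (1 - I * t)]
    have : conj (1 - I * (t : ℂ)) = 1 + I * t := by
      simp [map_sub, Complex.conj_ofReal]
    rw [this, ← hs₀', h0, map_zero]
  -- the twisted coefficients `c_v = ψ'(v) N(v)^{-it}`
  set c : HeightOneSpectrum (𝓞 K) → ℂ := fun v =>
    rayClassPrimeValue 𝔪 ψ v * ((Ideal.absNorm v.asIdeal : ℕ) : ℂ) ^ (-(I * t)) with hc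
  have hqpos : ∀ v : HeightOneSpectrum (𝓞 K), 0 < Ideal.absNorm v.asIdeal := fun v =>
    lt_trans zero_lt_one (NumberField.HeightOneSpectrum.one_lt_absNorm v)
  have hqne : ∀ v : HeightOneSpectrum (𝓞 K), ((Ideal.absNorm v.asIdeal : ℕ) : ℂ) ≠ 0 := fun v =>
    Nat.cast_ne_zero.mpr (hqpos v).ne'
  have hcle : ∀ v, ‖c v‖ ≤ 1 := fun v => by
    simp only [hc]
    rw [norm_mul, norm_natCast_cpow_neg_I_mul (hqpos v) t, mul_one]
    exact norm_rayClassPrimeValue_le hψle v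
  refine GaloisRepresentations.false_of_landauSeries hcle (A := 0) one_half_pos hGd.differentiableOn
    hG'd.differentiableOn hG1 hG'1 fun s hs => ?_
  -- the Euler products: `∏ (1 - c_v N v^{-s})⁻¹ = L(χ, s + it)`, `∏ (1 - c̄_v N v^{-s})⁻¹ = L(χ̄, s - it)`
  have hs1 : 1 < (s + I * t).re := by simpa using hs
  have hs2 : 1 < (s - I * t).re := by simpa using hs
  have hP1 : (fun v : HeightOneSpectrum (𝓞 K) =>
      (1 - c v * ((Ideal.absNorm v.asIdeal : ℕ) : ℂ) ^ (-s))⁻¹) =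
      fun v => (1 - rayClassPrimeValue 𝔪 ψ v *
        ((Ideal.absNorm v.asIdeal : ℕ) : ℂ) ^ (-(s + I * t)))⁻¹ := by
    funext v
    simp only [hc]
    rw [mul_assoc, ← cpow_add _ _ (hqne v), show -(I * (t : ℂ)) + -s = -(s + I * t) by ring]
  have hP2 : (fun v : HeightOneSpectrum (𝓞 K) =>
      (1 - conj (c v) * ((Ideal.absNorm v.asIdeal : ℕ) : ℂ) ^ (-s))⁻¹) =
      fun v => (1 - rayClassPrimeValue 𝔪 ψc v *
        ((Ideal.absNorm v.asIdeal : ℕ) : ℂ) ^ (-(s - I * t)))⁻¹ := by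
    funext v
    simp only [hc]
    rw [map_mul, conj_natCast_cpow, ← rayClassPrimeValue_conj, mul_assoc, ← cpow_add _ _ (hqne v)]
    have : conj (-(I * (t : ℂ))) + -s = -(s - I * t) := by
      simp [map_neg, map_mul, Complex.conj_I, Complex.conj_ofReal]
      ring
    rw [this]
  rw [GaloisRepresentations.cexp_genDirichlet_landau_eq hcle hs, hP1, hP2,
    (hasProd_rayClassLSeries_rayClassPrimeValue h𝔪 hψle hs1).tprod_eq,
    (hasProd_rayClassLSeries_rayClassPrimeValue h𝔪 hψcle hs2).tprod_eq, ← hg_eq _ hs1,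
    ← hg'eq _ hs2]
  simp only [hG, hG']
  ring

end Literature.NumberTheory.LFunctions

end
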